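import Mathlib.MeasureTheory.Measure.Prod
import Mathlib.Probability.Distributions.SetBernoulli
import Literature.Probability.Percolation.Percolation

/-!
# Inside/outside independence of Bernoulli site percolation (gluing two independent samples)

Helper file for the crux `QuadrupoleSelectionRule` (stmt-CriticalPhenomena-7029, informal) of route
`CardyFlipRusso` (sub-problem `CardyFormulaZ2`), line `Sketch`, generation 3 ("inside/outside"),
stub G1 "inside/outside independence of site percolation".

Gluing two independent samples `ω, η` of Bernoulli site percolation `P_p` on `V` along a set `S` of
sites — the sites outside `S` are read from the first sample, the sites inside `S` from the second,
`(ω, η) ↦ (ω \ S) ∪ (η ∩ S)` — gives again a sample of `P_p`: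

`((P_p ⊗ P_p).map fun (ω, η) => (ω \ S) ∪ (η ∩ S)) = P_p`            (`sitePercolation_prod_map_glue`).

This is what makes the abstract slot-shift identity `prod_real_shift_sub_eq_integral_map`
(file `CardyFlipRussoQuadrupoleSelectionRuleSlotShift.lean`) applicable to the flip response: the
inside randomness is the configuration in a mesoscopic disc `S` around the quadrilateral, the
outside randomness is the configuration off `S`, and the annealed law is their product.

Proof.  Site percolation is the image of a product `Measure.infinitePi μ` of one-site laws on
`V → Prop` under `f ↦ {i | f i}` (`ProbabilityTheory.setBernoulli_eq_map`).  For any family of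
probability measures `μ`, gluing two independent samples of `infinitePi μ` along `S`
(`(b₁, b₂) ↦ fun j => if j ∈ S then b₂ j else b₁ j`) gives a sample of `infinitePi μ`
(`infinitePi_prod_map_ite`): by the characterisation of `infinitePi` through finite boxes
(`Measure.eq_infinitePi`), since the preimage of a box `Set.pi I t` under the gluing map is the
product of the boxes over `I.filter (· ∉ S)` and `I.filter (· ∈ S)`.  The set-level gluing map is
conjugate to this one under `f ↦ {i | f i}`, and `Measure.map_prod_map`, `Measure.map_map` finish.
-/

noncomputable section

open MeasureTheory ProbabilityTheory Literature.Probability.Percolation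

namespace Summit.CriticalPhenomena.CardyFormulaZ2.Theorems

/-- **Gluing lemma for product measures.** For a family `μ` of probability measures and any set of
coordinates `A`, gluing two independent samples of `Measure.infinitePi μ` — coordinates in `A` from
the second sample, the others from the first — gives a sample of `Measure.infinitePi μ`. [folklore] -/
theorem infinitePi_prod_map_ite {ι : Type*} {X : ι → Type*} [∀ i, MeasurableSpace (X i)]
    (μ : (i : ι) → Measure (X i)) [∀ i, IsProbabilityMeasure (μ i)] (A : Set ι)
    [DecidablePred (· ∈ A)] :
    ((Measure.infinitePi μ).prod (Measure.infinitePi μ)).map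
        (fun q : (Π i, X i) × (Π i, X i) => fun j => if j ∈ A then q.2 j else q.1 j) =
      Measure.infinitePi μ := by
  have hmeas : Measurable
      (fun q : (Π i, X i) × (Π i, X i) => fun j => if j ∈ A then q.2 j else q.1 j) :=
    measurable_pi_lambda _ fun j => by
      by_cases hj : j ∈ A
      · simp only [if_pos hj]; fun_prop
      · simp only [if_neg hj]; fun_prop
  refine Measure.eq_infinitePi μ fun I t ht => ?_
  rw [Measure.map_apply hmeas (.pi I.countable_toSet fun j _ => ht j)]
  have hpre : (fun q : (Π i, X i) × (Π i, X i) => fun j => if j ∈ A then q.2 j else q.1 j) ⁻¹'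
        Set.pi ↑I t =
      Set.pi ↑(I.filter (· ∉ A)) t ×ˢ Set.pi ↑(I.filter (· ∈ A)) t := by
    ext ⟨ω, η⟩
    simp only [Set.mem_preimage, Set.mem_pi, Finset.mem_coe, Set.mem_prod, Finset.mem_filter]
    constructor
    · intro h
      refine ⟨fun j hj => ?_, fun j hj => ?_⟩
      · simpa [if_neg hj.2] using h j hj.1
      · simpa [if_pos hj.2] using h j hj.1
    · rintro ⟨h1, h2⟩ j hj
      by_cases hjA : j ∈ A
      · rw [if_pos hjA]; exact h2 j ⟨hj, hjA⟩
      · rw [if_neg hjA]; exact h1 j ⟨hj, hjA⟩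
  rw [hpre, Measure.prod_prod, Measure.infinitePi_pi _ (fun j _ => ht j),
    Measure.infinitePi_pi _ (fun j _ => ht j), mul_comm, Finset.prod_filter_mul_prod_filter_not]

/-- **Inside/outside independence of site percolation** (stub G1 of line `Sketch`, generation 3,
for the crux `QuadrupoleSelectionRule`).  Gluing two independent samples of Bernoulli site
percolation with density `p` along a set of sites `S` — outside `S` from the first sample, inside
`S` from the second — gives a sample: the image of `sitePercolation V p ⊗ sitePercolation V p`
under `(ω, η) ↦ (ω \ S) ∪ (η ∩ S)` is `sitePercolation V p`. [folklore] -/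
theorem sitePercolation_prod_map_glue (V : Type*) (p : unitInterval) (S : Set V) :
    ((sitePercolation V p).prod (sitePercolation V p)).map
        (fun q : SiteConfig V × SiteConfig V => (q.1 \ S) ∪ (q.2 ∩ S)) = sitePercolation V p := by
  classical
  -- measurability of `f ↦ {i | f i}`, of the set-level and of the `Prop`-level gluing maps
  have hmk : Measurable fun f : V → Prop => {i | f i} := measurable_setOf
  have hF : Measurable fun q : SiteConfig V × SiteConfig V => (q.1 \ S) ∪ (q.2 ∩ S) := by
    refine measurable_set_iff.2 fun j => ?_
    exact (((measurable_set_mem j).comp measurable_fst).and measurable_const).or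
      (((measurable_set_mem j).comp measurable_snd).and measurable_const)
  have hG : Measurable
      fun q : (V → Prop) × (V → Prop) => fun j => if j ∈ S then q.2 j else q.1 j :=
    measurable_pi_lambda _ fun j => by
      by_cases hj : j ∈ S
      · simp only [if_pos hj]; fun_prop
      · simp only [if_neg hj]; fun_prop
  -- the set-level gluing map is conjugate to the `Prop`-level one under `f ↦ {i | f i}`
  have hcomm : (fun q : SiteConfig V × SiteConfig V => (q.1 \ S) ∪ (q.2 ∩ S)) ∘
        Prod.map (fun f : V → Prop => {i | f i}) (fun f : V → Prop => {i | f i}) =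
      (fun f : V → Prop => {i | f i}) ∘
        fun q : (V → Prop) × (V → Prop) => fun j => if j ∈ S then q.2 j else q.1 j := by
    refine funext fun q => Set.ext fun j => ?_
    by_cases hj : j ∈ S <;> simp [hj]
  rw [sitePercolation, setBernoulli_eq_map, Measure.map_prod_map _ _ hmk hmk,
    Measure.map_map hF (hmk.prodMap hmk), hcomm, ← Measure.map_map hmk hG,
    infinitePi_prod_map_ite]

end Summit.CriticalPhenomena.CardyFormulaZ2.Theorems
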